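import Mathlib.RingTheory.Kaehler.Basic
import Mathlib.LinearAlgebra.Determinant
import HarnessLib

/-!
# Coordinates and Jacobian determinants under `KaehlerDifferential.map` (the chain rule for bases)

Topic `RingTheory/Derivation` (proofs only; no definitions, no named facts). For a square of
commutative rings `R → S`, `A → B` (towers `R → A → B`, `R → S → B`) Mathlib's
`KaehlerDifferential.map R S A B : Ω[A⁄R] →ₗ[A] Ω[B⁄S]` is `A`-linear. If a basis `b` of `Ω[A⁄R]`
is carried to a basis `b₁` of `Ω[B⁄S]` (`b₁ i = map (b i)` — e.g. `b i = d zᵢ`, `b₁ i = d zᵢ` for a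
localisation or a base change, Mathlib `KaehlerDifferential.map_D`), then coordinates and
determinants are carried by `algebraMap A B`:

* `repr_map_eq_algebraMap_repr` — `b₁.repr (map x) i = algebraMap A B (b.repr x i)`;
* `toMatrix_map_eq_map_toMatrix`, `det_map_eq_algebraMap_det` — **the Jacobian determinant of the
  image family is the image of the Jacobian determinant**: `b₁.det (map ∘ v) = algebraMap A B (b.det v)`
  (Bosch–Lütkebohmert–Raynaud, *Néron Models*, §2.1, functoriality of differentials / chain rule;
  used in §2.2 Prop. 11 and §4.2 for relative Jacobians of étale coordinates).

Cell `hodgecm-mathlib`, road W of `r₀` ((W0) infrastructure 2/3: transport of rational top forms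
along localisation, base change and isomorphisms).

## Sources

* S. Bosch, W. Lütkebohmert, M. Raynaud, *Néron Models*, Springer 1990, §2.1 Prop. 2 / §2.2
  Prop. 11 (differentials and coordinates under base change and étale maps). [BLRNeronModels1990]
-/

noncomputable section

namespace Literature.RingTheory.Derivation

open KaehlerDifferential

variable {R S A B : Type*} [CommRing R] [CommRing S] [CommRing A] [CommRing B]
  [Algebra R A] [Algebra S B] [Algebra A B] [Algebra R B] [Algebra R S]
  [IsScalarTower R A B] [IsScalarTower R S B] [SMulCommClass S A B]
  {ι : Type*} (b : Module.Basis ι A Ω[A⁄R]) (b₁ : Module.Basis ι B Ω[B⁄S])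
  (hb₁ : ∀ i, b₁ i = KaehlerDifferential.map R S A B (b i))

include hb₁ in
/-- **Coordinates are carried by `algebraMap`**: if the basis `b` of `Ω[A⁄R]` maps to the basis `b₁` of
`Ω[B⁄S]` under `KaehlerDifferential.map`, then the `b₁`-coordinates of `map x` are the images of the
`b`-coordinates of `x` (both sides are `A`-linear in `x` and agree on `b`).
[cite: BLRNeronModels1990, §2.1 Prop. 2] -/
theorem repr_map_eq_algebraMap_repr (x : Ω[A⁄R]) (i : ι) :
    b₁.repr (KaehlerDifferential.map R S A B x) i = algebraMap A B (b.repr x i) := by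
  classical
  -- the two sides as `A`-linear maps `Ω[A⁄R] → B`
  let π₁ : (ι →₀ B) →ₗ[B] B := Finsupp.lapply i
  let ρ₁ : Ω[B⁄S] →ₗ[B] (ι →₀ B) := b₁.repr.toLinearMap
  let F : Ω[A⁄R] →ₗ[A] B :=
    ((π₁ ∘ₗ ρ₁).restrictScalars A) ∘ₗ KaehlerDifferential.map R S A B
  let π₀ : (ι →₀ A) →ₗ[A] A := Finsupp.lapply i
  let G : Ω[A⁄R] →ₗ[A] B := (Algebra.linearMap A B) ∘ₗ (π₀ ∘ₗ b.repr.toLinearMap)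
  have hFG : F = G := by
    refine b.ext fun j => ?_
    simp only [F, G, π₁, ρ₁, π₀, LinearMap.coe_comp, LinearMap.coe_restrictScalars,
      LinearEquiv.coe_coe, Function.comp_apply, Finsupp.lapply_apply, Algebra.linearMap_apply,
      ← hb₁, Module.Basis.repr_self]
    by_cases hij : j = i
    · subst hij; simp
    · simp [hij]
  exact congrArg (fun T : Ω[A⁄R] →ₗ[A] B => T x) hFG

include hb₁ in
/-- The matrix of the image family `map ∘ v` in the basis `b₁` is the image of the matrix of `v` in
the basis `b`. [cite: BLRNeronModels1990, §2.1 Prop. 2] -/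
theorem toMatrix_map_eq_map_toMatrix [Fintype ι] [DecidableEq ι] (v : ι → Ω[A⁄R]) :
    b₁.toMatrix (fun j => KaehlerDifferential.map R S A B (v j)) =
      (b.toMatrix v).map (algebraMap A B) := by
  ext i j
  rw [Module.Basis.toMatrix_apply, Matrix.map_apply, Module.Basis.toMatrix_apply,
    repr_map_eq_algebraMap_repr b b₁ hb₁]

include hb₁ in
/-- **Chain rule for Jacobian determinants**: the determinant, in the basis `b₁`, of the image family
`map ∘ v` is the image under `algebraMap A B` of the determinant of `v` in the basis `b`
(`RingHom.map_det`). [cite: BLRNeronModels1990, §2.2 Prop. 11 (proof)] -/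
theorem det_map_eq_algebraMap_det [Fintype ι] [DecidableEq ι] (v : ι → Ω[A⁄R]) :
    b₁.det (fun j => KaehlerDifferential.map R S A B (v j)) = algebraMap A B (b.det v) := by
  rw [Module.Basis.det_apply, Module.Basis.det_apply, toMatrix_map_eq_map_toMatrix b b₁ hb₁,
    ← RingHom.mapMatrix_apply, ← RingHom.map_det]

/-- The hypothesis `b₁ i = map (b i)` for EXACT bases: if `b i = d zᵢ` and `b₁ i = d (zᵢ)` (image
in `B`) then `b₁ i = map (b i)` (Mathlib `KaehlerDifferential.map_D`). [cite: BLRNeronModels1990, §2.1 Prop. 2] -/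
theorem basis_map_of_eq_D {z : ι → A} (b : Module.Basis ι A Ω[A⁄R]) (b₁ : Module.Basis ι B Ω[B⁄S])
    (hb : ∀ i, b i = KaehlerDifferential.D R A (z i))
    (hb₁' : ∀ i, b₁ i = KaehlerDifferential.D S B (algebraMap A B (z i))) (i : ι) :
    b₁ i = KaehlerDifferential.map R S A B (b i) := by
  rw [hb₁', hb, KaehlerDifferential.map_D]

/-- **Chain rule for exact bases**: with `b i = d zᵢ`, `b₁ i = d (zᵢ)` and families `d vⱼ`, `d (vⱼ)`,
`b₁.det (d (vⱼ))ⱼ = algebraMap A B (b.det (d vⱼ)ⱼ)`. [cite: BLRNeronModels1990, §2.2 Prop. 11 (proof)] -/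
theorem det_D_eq_algebraMap_det_D [Fintype ι] [DecidableEq ι] {z : ι → A}
    (b : Module.Basis ι A Ω[A⁄R]) (b₁ : Module.Basis ι B Ω[B⁄S])
    (hb : ∀ i, b i = KaehlerDifferential.D R A (z i))
    (hb₁' : ∀ i, b₁ i = KaehlerDifferential.D S B (algebraMap A B (z i))) (v : ι → A) :
    b₁.det (fun j => KaehlerDifferential.D S B (algebraMap A B (v j))) =
      algebraMap A B (b.det fun j => KaehlerDifferential.D R A (v j)) := by
  rw [← det_map_eq_algebraMap_det b b₁ (basis_map_of_eq_D b b₁ hb hb₁')]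
  simp only [KaehlerDifferential.map_D]

end Literature.RingTheory.Derivation

end
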